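import Literature.Analysis.FluidPDE.NSBoundedMildOseenAssembly
import Literature.Analysis.FluidPDE.TaoLocalisationHolds
import Literature.Analysis.FluidPDE.GKPCriticalElementsProofs
import HarnessLib

/-!
# The critical Besov continuation criterion: the dependency record after Tao's Cor. 11.1

Analysis/FluidPDE assembly file (proofs only, no definitions or named facts) for the named fact
`Literature.Analysis.FluidPDE.hasSmoothExtensionPast_of_eHomBesovNorm_bounded`
(`NSCriticalClosure.lean`; Gallagher–Koch–Planchon 2016, Thm. 1, in contrapositive form for
classical Leray–Hopf solutions from rapidly decaying data: a bounded critical Besov norm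
`Ḃ^{-1+3/r}_{r,q}`, `3 < r, q < ∞`, on `[0, T)` gives a smooth extension past `T`).

State of the decomposition. `NSCriticalClosureBesovBounded.lean` and
`NSCriticalClosureBesovAssembly.lean` reduce the fact to GKP Thm. 1 (`gkp_besov_blowup`), two
Tao 2013 facts and the KNSS 2009 smoothing of bounded Besov mild solutions;
`NSBoundedMildOseenAssembly.lean` replaces the latter by the single local fact
(L) `knss2009_local_smoothing ℝ³` (`hasSmoothExtensionPast_of_eHomBesovNorm_bounded_of_gkp_tao_local`).
Meanwhile Tao 2013, Cor. 11.1 (`tao2011_hasBoundedSobolevNormsOn`) has been **discharged**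
(`tao2011_hasBoundedSobolevNormsOn_holds`, `TaoLocalisationHolds.lean`). This file feeds that
discharge in, so that the dependency record of the fact lists exactly **three** named facts:

* `gkp_besov_blowup` — GKP 2016, Thm. 1 (blow-up of the critical Besov norm of a maximal Besov
  mild solution), itself reduced in `GKPCriticalElements(Proofs).lean` to GKP (1.9),
  Props. 2.1–2.2 and the statement of Prop. 2.3 (`gkp_besov_blowup_of_gkp`: persistence of
  regularity, existence of a critical element, its decay in `𝓢'` at the blow-up time, rigidity);
* `tao2011_smooth_local_existence` — Tao 2013, Thm. 5.4 (ii)+(iv) (smooth local solutions from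
  `H¹ ∩ H^∞` data with the `X^k` bounds);
* `knss2009_local_smoothing ℝ³` — KNSS 2009, Prop. 4.1 in its quantitative short-time form.

The grouping is recorded (`…_of_gkp_taoLocal_knssLocal`) together with its conjunction form. (An
earlier version also recorded the grouping with GKP Thm. 1 opened up into GKP §2.1 —
`…_of_gkpProps_taoLocal_knssLocal`, `…_of_and6`: (1.9), Props. 2.1, 2.2, 2.3, Tao Thm. 5.4, KNSS
(L). The tree-class rendering `gkp_rigidity` of Prop. 2.3 was merged back into the proof obligation
of Thm. 1 on review (2026-08-15, D-0026: mis-stated over the tree's class, Step 3 of the printed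
proof by contradiction, and a corollary of `gkp_besov_blowup` itself,
`gkp_rigidity_of_gkp_besov_blowup`), so Prop. 2.3 is no longer a named fact of the tree and that
record — a one-line composition of `…_of_gkp_taoLocal_knssLocal` with `gkp_besov_blowup_of_gkp`,
which keeps the statement of Prop. 2.3 as an explicit hypothesis — is dropped.) Kept in a separate
leaf file so that the proof imports of `TaoLocalisationHolds.lean` (Tao §§8–11) stay out of the
statement and decomposition files.

## Mathlib / tree search

Tree (`lean search '_holds'` for the five original leaves): discharged are
`tao2011_isMildNSSolutionOn_of_memSobolevX_holds` (`TaoH1MildProofs.lean`, already fed in by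
`NSCriticalClosureBesovAssembly.lean`) and `tao2011_hasBoundedSobolevNormsOn_holds`
(`TaoLocalisationHolds.lean`, fed in here); inside the KNSS leaf, (A) `oseenMild_of_bounded_…_holds`,
(R) `oseenMild_restart_holds`, (C) `classical_of_smooth_isMildNSSolutionOn_holds` are fed in by
`NSBoundedMildOseenAssembly.lean`. No `_holds` exists yet for `gkp_besov_blowup`,
`tao2011_smooth_local_existence`, `knss2009_local_smoothing`. Mathlib: no Navier–Stokes theory.

## References

* I. Gallagher, G. S. Koch, F. Planchon, *Blow-up of critical Besov norms at a potential
  Navier–Stokes singularity*, Comm. Math. Phys. 343 (2016) 39–82 = arXiv:1407.4156, Thm. 1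
  (p. 5) and §2.1 (p. 6). [GKP2016]
* T. Tao, *Localisation and compactness properties of the Navier–Stokes global regularity
  problem*, Anal. PDE 6 (2013) 25–107 = arXiv:1108.1165, Thm. 5.4, Cor. 4.3, Cor. 11.1. [Tao2011]
* G. Koch, N. Nadirashvili, G. Seregin, V. Šverák, *Liouville theorems for the Navier–Stokes
  equations and applications*, Acta Math. 203 (2009) 83–105 = arXiv:0709.3599, §4, Prop. 4.1.
  [KochNadirashviliSereginSverak2009]
-/

noncomputable section

namespace Literature.Analysis.FluidPDE

-- `linter.deprecated` is switched off for the next declaration only: it names the deprecated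
-- (mis-stated, 2026-08-15) tree-class rendering(s) of GKP Thm. 1 (`gkp_besov_blowup`,
-- `CriticalRegularity.lean`), kept unchanged for their users until the faithful path-space forms
-- are vendored (see those files).
set_option linter.deprecated false in
/-- **The critical Besov continuation criterion from the three remaining named facts** (GKP 2016,
Thm. 1, contrapositive; identification through Tao 2013 and the KNSS local smoothing theory):
`hasSmoothExtensionPast_of_eHomBesovNorm_bounded_of_gkp_tao_local` with Tao's Cor. 11.1 supplied
by its discharge `tao2011_hasBoundedSobolevNormsOn_holds`. [cite: GKP2016, Thm. 1] -/
theorem hasSmoothExtensionPast_of_eHomBesovNorm_bounded_of_gkp_taoLocal_knssLocal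
    (hG : gkp_besov_blowup) (hTao : tao2011_smooth_local_existence)
    (hL : knss2009_local_smoothing (EuclideanSpace ℝ (Fin 3))) :
    hasSmoothExtensionPast_of_eHomBesovNorm_bounded :=
  hasSmoothExtensionPast_of_eHomBesovNorm_bounded_of_gkp_tao_local hG
    tao2011_hasBoundedSobolevNormsOn_holds hTao hL

-- `linter.deprecated` is switched off for the next declaration only: it names the deprecated
-- (mis-stated, 2026-08-15) tree-class rendering(s) of GKP Thm. 1 (`gkp_besov_blowup`,
-- `CriticalRegularity.lean`), kept unchanged for their users until the faithful path-space forms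
-- are vendored (see those files).
set_option linter.deprecated false in
/-- **The route's dependency record, updated**: `hasSmoothExtensionPast_of_eHomBesovNorm_bounded`
holds as soon as GKP Thm. 1, Tao's Thm. 5.4 (ii)+(iv) and the KNSS local theory (L) are
discharged; stated as the implication from their conjunction. [cite: GKP2016, Thm. 1] -/
theorem hasSmoothExtensionPast_of_eHomBesovNorm_bounded_of_and3
    (h : gkp_besov_blowup ∧ tao2011_smooth_local_existence ∧
      knss2009_local_smoothing (EuclideanSpace ℝ (Fin 3))) :
    hasSmoothExtensionPast_of_eHomBesovNorm_bounded :=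
  hasSmoothExtensionPast_of_eHomBesovNorm_bounded_of_gkp_taoLocal_knssLocal h.1 h.2.1 h.2.2

end Literature.Analysis.FluidPDE

end
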